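import Summits.PneNP.PneNP.Theorems.ChebyshevTracialDesignTiltedSmallBlockClasses
import Summits.PneNP.PneNP.Theorems.ChebyshevTracialDesignSmallBlockMaskAverageCutoff
import Literature.Combinatorics.Optimization.ShellLawRelativeLevelSmoothness
import HarnessLib

/-!
# Cell pnp-psdrank, route `ChebyshevTracialDesign`: TILTED SMALL BLOCKS — the `M`-average in every type-constant direction field
# (brick 153; crux `TracialDecayExp20`, stmt-PneNP-19878)

Brick 153 (prover g30; eng MEMO-26 §4, prover MEMO-32 §8 (iii-a), MEMO-33 §3). Brick 152 (`…TiltedSmallBlockClasses`) prices the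
(CG_1′) containment form of a one-block mask `ψ(|U∩H|)` in every type-constant direction PER MATCHING, for matchings with `a ≤ a₀`
edges inside `H`; the matchings with more internal edges are charged to the `a`-tail of the matching measure exactly as in the
untilted `M`-average T-K4/T-K4b (`ChebyshevTracialDesignSmallBlockMaskAverage{,Cutoff}`: `avg_le_of_split`,
`card_pmatch_internal_gt_le_cutoff`):

* §1 `tilted_value_le_trivial` (`|PM|·Σ_U W ψ C_v² ≤ n²GB_v` for any `|v| ≤ 1`).
* §2 `tilted_value_le_uniform` (brick 152 made uniform in `a ≤ a₀`: `≤ B_v G (5t+5T+4)² 3^{a₀} θ^{D−a₀−1}` once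
  `((T−1)/2)·¼(h/R)²e^{3h/R} ≤ θ ≤ 1`; the three constants of a type-constant direction are read off by choice).
* §3 **`tilted_designValue_avg_le_cutoff`**: for a direction FIELD `v_M` (`|v_M| ≤ 1`, type-constant for `(H, M)` at every `M`):
  `Σ_M Σ_U W(U,M)ψ(|U∩H|)(Σ_p v_M(p)x_px_{πp})² ≤ B_vG(5t+5T+4)²3^{a₀}θ^{D−a₀−1} + (h+1)ρ^{a₀+1−a₁}·n²GB_v`, and the HEADLINE
  **`tilted_designValue_avg_le_three_pow`**: `≤ B_v·G·((5t+5T+4)² + (h+1)n²)·(1/3)^{⌊D/2⌋−1}` for `9h(h+1) ≤ n−2h+1`,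
  `((T−1)/2)·¼(h/R)²e^{3h/R} ≤ 1/9`, `4 ≤ D`, `D/2 ≤ T+1` (T-K4's `…avg_le_three_pow` pattern); with a CUT-OFF `a₁ ≤ ⌊D/2⌋`,
  `9h(h+1) ≤ (2a₁+1)(n−2h+2a₁+1)` (blocks up to `≍ √(n·D)`): **`tilted_designValue_avg_le_cutoff_pow`**
  `≤ B_v·G·((5t+5T+4)²(1/3)^{⌊D/2⌋−1} + (h+1)n²(1/9)^{⌊D/2⌋−a₁})`.
READING (MEMO-33 §3): (CG_1′) for the one-block mask class on SMALL blocks (`|H| ≲ √n/3`) in every TYPE-CONSTANT direction field,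
`M`-averaged, EFFECTIVE (no `∃ n₀`). By brick 148 §4 (`colourSymmetric_allDirections_reduction`) and brick 150b
(`colourSymmetric_amplitudeOne_of_typeConstant`) this is the input `Btc` of the all-directions bound and of the 𝒜₁ rung for small-block
masks (brick 154). WHAT THIS FILE DOES NOT DO: blocks with `√(nD) ≲ |H| < n/2`; anything on `TracialDecayExp20` itself, psd rank of P_PM(K_n), or P vs NP.
[cite: Rothvoss2017, §2 (PDF pp. 5–6)] [cite: Agarwal2000DifferenceEquations, Remark 1.8.1 (1.8.8)]
Stature: support/instrument (kernel lane, no defs, axioms standard). Supports stmt-PneNP-19878.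
-/

set_option linter.dupNamespace false -- `Summit.PneNP.PneNP.…`: summit = sub-problem (D-0017)

noncomputable section

namespace Summit.PneNP.PneNP.Theorems.ChebyshevTracialDesignTiltedSmallBlockAverage

open Finset Literature.Barriers.PneNP Literature.Combinatorics.Optimization
open Literature.Combinatorics.Optimization.ShellStep Literature.Combinatorics.SimpleGraph.CycleSpace
open Summit.PneNP.PneNP.Theorems.ChebyshevTracialDesignShellOperatorForm (designValue_eq_shellAvg)
open Summit.PneNP.PneNP.Theorems.ChebyshevTracialDesignCrossingPlaneAverage (card_reps_vB_eq_card_crosses)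
open Summit.PneNP.PneNP.Theorems.ChebyshevTracialDesignSmallBlockMaskAverage (choose_mul_pow_le_mul_pow qParam_mono rho_hyp_of_le)
open Summit.PneNP.PneNP.Theorems.ChebyshevTracialDesignSmallBlockMaskAverageCutoff (avg_le_of_split
  card_pmatch_internal_gt_le_cutoff rho_hyp_cutoff)
open Summit.PneNP.PneNP.Theorems.ChebyshevTracialDesignTiltedSmallBlockClasses (smallBlockHH_tilted_designValue_le)

variable {n : ℕ}

/-! ### §1 The trivial per-matching bound -/

/-- **Trivial bound.** For `|ψ| ≤ G` on `[0,t]` and any direction `|v_p| ≤ 1`: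
`|PM|·Σ_U W(U,M)·ψ(|U∩H|)·(Σ_p v_p x_p x_{πp})² ≤ n²·G·B_v`. [cite: Rothvoss2017, §2 (PDF p. 6)] -/
theorem tilted_value_le_trivial {t T D : ℕ} {Bv : ℝ} {C : Finset ℕ} {w : ℕ → ℝ} (hdes : IsExactDesign n t T D Bv C w)
    (M : PMatch n) (H : Finset (Fin n)) (ψ : ℤ → ℝ) {G : ℝ} (hG0 : 0 ≤ G)
    (hG : ∀ x ∈ Icc (0 : ℤ) ((t : ℕ) : ℤ), |ψ x| ≤ G) (v : Fin n → ℝ) (hv : ∀ p, |v p| ≤ 1) :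
    (Fintype.card (PMatch n) : ℝ) * ∑ U : OddSet n, levelWeight n t C w U M *
        (ψ ((U.1 ∩ H).card : ℤ) *
          (∑ p : Fin n, v p * ((if p ∈ U.1 then (1 : ℝ) else 0) * (if M.2.partner p ∈ U.1 then (1 : ℝ) else 0))) ^ 2) ≤
      (n : ℝ) ^ 2 * G * Bv := by
  have hPM : (Fintype.card (PMatch n) : ℝ) ≠ 0 := Nat.cast_ne_zero.2 (Fintype.card_pos_iff.2 ⟨M⟩).ne'
  set F : Finset (Fin n) → ℝ := fun U' => ψ ((U' ∩ H).card : ℤ) *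
    (∑ p : Fin n, v p * ((if p ∈ U' then (1 : ℝ) else 0) * (if M.2.partner p ∈ U' then (1 : ℝ) else 0))) ^ 2 with hF
  rw [designValue_eq_shellAvg t hdes.1 C w M F, ← mul_assoc, mul_inv_cancel₀ hPM, one_mul]
  have hform : ∀ U' : Finset (Fin n),
      |∑ p : Fin n, v p * ((if p ∈ U' then (1 : ℝ) else 0) * (if M.2.partner p ∈ U' then (1 : ℝ) else 0))| ≤ n := by
    intro U'
    refine (abs_sum_le_sum_abs _ _).trans ?_
    calc ∑ p : Fin n, |v p * ((if p ∈ U' then (1 : ℝ) else 0) * (if M.2.partner p ∈ U' then (1 : ℝ) else 0))|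
        ≤ ∑ _p : Fin n, (1 : ℝ) := sum_le_sum fun p _ => by
          rw [abs_mul]
          refine mul_le_one₀ (hv p) (abs_nonneg _) ?_
          rw [abs_mul]
          refine mul_le_one₀ ?_ (abs_nonneg _) ?_ <;> split_ifs <;> simp
      _ = n := by simp
  have hb : ∀ c ∈ C, |(∑ U' ∈ shell M.2.partner t c, F U') / ((shell M.2.partner t c).card : ℝ)| ≤ (n : ℝ) ^ 2 * G := by
    intro c _
    have hU : ∀ U' ∈ shell M.2.partner t c, |F U'| ≤ (n : ℝ) ^ 2 * G := by
      intro U' hU'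
      have hUt : U'.card = t := ((mem_shell).1 hU').1
      have hx : ((U' ∩ H).card : ℤ) ∈ Icc (0 : ℤ) ((t : ℕ) : ℤ) := by
        rw [mem_Icc]; refine ⟨by positivity, ?_⟩
        have := card_le_card (inter_subset_left (s₁ := U') (s₂ := H))
        rw [hUt] at this; exact_mod_cast this
      rw [hF]
      simp only
      rw [abs_mul, abs_pow, mul_comm]
      exact mul_le_mul (pow_le_pow_left₀ (abs_nonneg _) (hform U') 2) (hG _ hx) (abs_nonneg _) (by positivity)
    by_cases h0 : (shell M.2.partner t c).card = 0
    · rw [h0, Nat.cast_zero, div_zero, abs_zero]; positivity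
    have hpos : (0 : ℝ) < (shell M.2.partner t c).card := by positivity
    rw [abs_div, abs_of_pos hpos, div_le_iff₀ hpos]
    refine (abs_sum_le_sum_abs _ _).trans ?_
    calc _ ≤ ∑ _U' ∈ shell M.2.partner t c, (n : ℝ) ^ 2 * G := sum_le_sum hU
      _ = (n : ℝ) ^ 2 * G * (shell M.2.partner t c).card := by rw [sum_const, nsmul_eq_mul]; ring
  have hvar : ∑ c ∈ C, |w c| ≤ Bv := hdes.2.2.2.2.2.2
  refine (le_abs_self _).trans ((abs_sum_le_sum_abs _ _).trans ?_)
  calc _ ≤ ∑ c ∈ C, |w c| * ((n : ℝ) ^ 2 * G) := by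
        refine sum_le_sum fun c hc => ?_
        rw [abs_mul]
        exact mul_le_mul_of_nonneg_left (hb c hc) (abs_nonneg _)
    _ = (∑ c ∈ C, |w c|) * ((n : ℝ) ^ 2 * G) := by rw [sum_mul]
    _ ≤ Bv * ((n : ℝ) ^ 2 * G) := mul_le_mul_of_nonneg_right hvar (by positivity)
    _ = (n : ℝ) ^ 2 * G * Bv := by ring

/-! ### §2 The uniform per-matching bound for type-constant directions -/

/-- **Brick 152 made uniform in the number of internal edges.** For an exact design `(n,t,T,D,B_v,C,w)` (`n = 2N`, `t = 2s₀+1`), a block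
`|H| = h`, `a₀ + 2 ≤ D`, `a₀ ≤ T`, `R ≥ 1` with `R + 3(D+1) + h + (T−1)/2 ≤ s₀`, `R + 3(D+1) + h + s₀ + (T−1)/2 + 2 ≤ N`, `(h/R)²e^{3h/R} ≤ 2`,
`((T−1)/2)·¼(h/R)²e^{3h/R} ≤ θ ≤ 1`, `0 ≤ ψ ≤ G`, a matching `M` with at most `a₀` edges inside `H`, and a direction `v` that is
TYPE-CONSTANT for `(H, M)` (constant on the `HH`-type, on the mixed, and on the `H̄H̄`-type vertices) with `|v| ≤ 1`:
`|PM|·Σ_U W(U,M)·ψ(|U∩H|)·(Σ_p v_p x_p x_{πp})² ≤ B_v·G·(5t+5T+4)²·3^{a₀}·θ^{D−a₀−1}`. [cite: Rothvoss2017, §2 (PDF pp. 5–6)]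
[cite: Agarwal2000DifferenceEquations, Remark 1.8.1 (1.8.8)] -/
theorem tilted_value_le_uniform {t T D : ℕ} {Bv : ℝ} {C : Finset ℕ} {w : ℕ → ℝ}
    (hdes : IsExactDesign n t T D Bv C w) {N : ℕ} (hn : (univ : Finset (Fin n)).card = 2 * N)
    (H : Finset (Fin n)) {h s₀ a₀ R : ℕ} (hh : H.card = h) (ht : t = 2 * s₀ + 1) (ha₀ : a₀ + 2 ≤ D) (ha₀T : a₀ ≤ T)
    (hR : 1 ≤ R) (hR1 : R + 3 * (D + 1) + h + (T - 1) / 2 ≤ s₀) (hR2 : R + 3 * (D + 1) + h + s₀ + (T - 1) / 2 + 2 ≤ N)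
    (hq : ((h : ℝ) / R) ^ 2 * Real.exp (3 * h / R) ≤ 2) {θ : ℝ}
    (hθ : ((((T - 1) / 2 : ℕ)) : ℝ) * ((1 / 4 : ℝ) * ((h : ℝ) / R) ^ 2 * Real.exp (3 * h / R)) ≤ θ) (hθ1 : θ ≤ 1)
    (ψ : ℤ → ℝ) {G : ℝ} (hG0 : 0 ≤ G) (hG : ∀ x ∈ Icc (0 : ℤ) (t : ℤ), |ψ x| ≤ G)
    (hψ0 : ∀ x ∈ Icc (0 : ℤ) (t : ℤ), 0 ≤ ψ x) (M : PMatch n)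
    (hM : H.card < (M.1.filter (Crosses H)).card + 2 * (a₀ + 1))
    (v : Fin n → ℝ) (hv : ∀ p, |v p| ≤ 1)
    (hvA : ∀ p p', p ∈ H → M.2.partner p ∈ H → p' ∈ H → M.2.partner p' ∈ H → v p = v p')
    (hvB : ∀ p p', ((p ∈ H ∧ M.2.partner p ∉ H) ∨ (p ∉ H ∧ M.2.partner p ∈ H)) →
      ((p' ∈ H ∧ M.2.partner p' ∉ H) ∨ (p' ∉ H ∧ M.2.partner p' ∈ H)) → v p = v p')
    (hvD : ∀ p p', p ∉ H → M.2.partner p ∉ H → p' ∉ H → M.2.partner p' ∉ H → v p = v p') :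
    (Fintype.card (PMatch n) : ℝ) * ∑ U : OddSet n, levelWeight n t C w U M *
        (ψ ((U.1 ∩ H).card : ℤ) *
          (∑ p : Fin n, v p * ((if p ∈ U.1 then (1 : ℝ) else 0) * (if M.2.partner p ∈ U.1 then (1 : ℝ) else 0))) ^ 2) ≤
      Bv * G * (5 * (t : ℝ) + 5 * T + 4) ^ 2 * ((3 : ℝ) ^ a₀ * θ ^ (D - a₀ - 1)) := by
  classical
  have hBv : 0 ≤ Bv := le_trans (sum_nonneg fun c _ => abs_nonneg _) hdes.2.2.2.2.2.2
  have hθ0 : 0 ≤ θ := le_trans (by positivity) hθ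
  set π := M.2.partner with hπdef
  have hπ : ∀ v, π (π v) = v := partner_partner M
  have hπ' : ∀ v, π v ≠ v := partner_ne M
  obtain ⟨a, ha⟩ : ∃ a, (reps π (vAA π univ H)).card = a := ⟨_, rfl⟩
  obtain ⟨b, hb⟩ : ∃ b, (reps π (vBH π univ H ∪ vBN π univ H)).card = b := ⟨_, rfl⟩
  have hab : h = 2 * a + b := by rw [← hh, card_eq_two_mul_add_of_types hπ hπ' H, ha, hb]
  have hbcr : b = (M.1.filter (Crosses H)).card := by rw [← hb, hπdef, card_reps_vB_eq_card_crosses M H]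
  have haa₀ : a ≤ a₀ := by rw [← hbcr, hh] at hM; omega
  have hbh : b ≤ h := by omega
  have hqb : ((b : ℝ) / R) ^ 2 * Real.exp (3 * b / R) ≤ 2 := by
    have h4 := qParam_mono (R := R) hbh
    linarith
  -- the three constants of the direction
  set u₂ : ℝ := if hx : ∃ p, p ∈ H ∧ π p ∈ H then v hx.choose else 0 with hu₂
  set u₁ : ℝ := if hx : ∃ p, (p ∈ H ∧ π p ∉ H) ∨ (p ∉ H ∧ π p ∈ H) then v hx.choose else 0 with hu₁
  set u₀ : ℝ := if hx : ∃ p, p ∉ H ∧ π p ∉ H then v hx.choose else 0 with hu₀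
  have hu₂' : |u₂| ≤ 1 := by
    rw [hu₂]; split_ifs
    · exact hv _
    · simp
  have hu₁' : |u₁| ≤ 1 := by
    rw [hu₁]; split_ifs
    · exact hv _
    · simp
  have hu₀' : |u₀| ≤ 1 := by
    rw [hu₀]; split_ifs
    · exact hv _
    · simp
  have hvA' : ∀ p, p ∈ H → π p ∈ H → v p = u₂ := by
    intro p hp hπp
    have hx : ∃ p, p ∈ H ∧ π p ∈ H := ⟨p, hp, hπp⟩
    rw [hu₂, dif_pos hx]
    exact hvA p _ hp hπp hx.choose_spec.1 hx.choose_spec.2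
  have hvB' : ∀ p, (p ∈ H ∧ π p ∉ H) ∨ (p ∉ H ∧ π p ∈ H) → v p = u₁ := by
    intro p hp
    have hx : ∃ p, (p ∈ H ∧ π p ∉ H) ∨ (p ∉ H ∧ π p ∈ H) := ⟨p, hp⟩
    rw [hu₁, dif_pos hx]
    exact hvB p _ hp hx.choose_spec
  have hvD' : ∀ p, p ∉ H → π p ∉ H → v p = u₀ := by
    intro p hp hπp
    have hx : ∃ p, p ∉ H ∧ π p ∉ H := ⟨p, hp, hπp⟩
    rw [hu₀, dif_pos hx]
    exact hvD p _ hp hπp hx.choose_spec.1 hx.choose_spec.2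
  have hV := smallBlockHH_tilted_designValue_le hdes M hn H ha hb (D' := D - a - 2) ht (by omega) (by omega) hR
    (by omega) (by omega) hqb ψ hG hψ0 v u₂ u₁ u₀ hu₂' hu₁' hu₀' hvA' hvB' hvD'
  set qb : ℝ := (1 / 4 : ℝ) * ((b : ℝ) / R) ^ 2 * Real.exp (3 * b / R) with hqbdef
  have hqb0 : 0 ≤ qb := by rw [hqbdef]; positivity
  have hJq : ((((T - 1) / 2 : ℕ)) : ℝ) * qb ≤ θ :=
    le_trans (mul_le_mul_of_nonneg_left (qParam_mono (R := R) hbh) (by positivity)) hθ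
  have hC : ((((T - 1) / 2).choose (D - a - 2 + 1) : ℕ) : ℝ) * qb ^ (D - a - 2 + 1) ≤ θ ^ (D - a₀ - 1) :=
    calc _ ≤ (((((T - 1) / 2 : ℕ)) : ℝ) * qb) ^ (D - a - 2 + 1) := choose_mul_pow_le_mul_pow _ _ hqb0
      _ ≤ θ ^ (D - a - 2 + 1) := pow_le_pow_left₀ (by positivity) hJq _
      _ ≤ θ ^ (D - a₀ - 1) := pow_le_pow_of_le_one hθ0 hθ1 (by omega)
  have h3 : (3 : ℝ) ^ a ≤ (3 : ℝ) ^ a₀ := pow_le_pow_right₀ (by norm_num) haa₀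
  calc _ ≤ Bv * ((((T - 1) / 2).choose (D - a - 2 + 1) : ℕ) : ℝ) *
        ((3 : ℝ) ^ a * (G * (5 * (t : ℝ) + 5 * T + 4) ^ 2 * qb ^ (D - a - 2 + 1))) := hV
    _ = Bv * G * (5 * (t : ℝ) + 5 * T + 4) ^ 2 *
        ((3 : ℝ) ^ a * (((((T - 1) / 2).choose (D - a - 2 + 1) : ℕ) : ℝ) * qb ^ (D - a - 2 + 1))) := by ring
    _ ≤ Bv * G * (5 * (t : ℝ) + 5 * T + 4) ^ 2 * ((3 : ℝ) ^ a₀ * θ ^ (D - a₀ - 1)) :=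
        mul_le_mul_of_nonneg_left (mul_le_mul h3 hC (by positivity) (by positivity)) (by positivity)

/-! ### §3 The average over all matchings -/

/-- **TILTED SMALL BLOCKS, THE `M`-AVERAGE IN EVERY TYPE-CONSTANT DIRECTION FIELD (brick 153).** For an exact design
`(n,t,T,D,B_v,C,w)` (`n = 2N`, `t = 2s₀+1`), a block `|H| = h`, cut-offs `a₁ ≤ a₀ + 1`, `a₀ + 2 ≤ D`, `a₀ ≤ T`, `R ≥ 1` with
`R + 3(D+1) + h + (T−1)/2 ≤ s₀`, `R + 3(D+1) + h + s₀ + (T−1)/2 + 2 ≤ N`, `(h/R)²e^{3h/R} ≤ 2`, `((T−1)/2)·¼(h/R)²e^{3h/R} ≤ θ ≤ 1`,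
`ρ ≥ 0` with `(b+1)(b+2) ≤ ρ(h−b)(n−h−b)` for `b + 2a₁ < h`, `0 ≤ ψ ≤ G`, and a direction FIELD `v_M` with `|v_M| ≤ 1` that is
type-constant for `(H, M)` at every `M`:
`Σ_M Σ_U W(U,M)·ψ(|U∩H|)·(Σ_p v_M(p) x_p x_{πp})² ≤ B_v·G·(5t+5T+4)²·3^{a₀}·θ^{D−a₀−1} + (h+1)·ρ^{a₀+1−a₁}·(n²·G·B_v)`.
[cite: Rothvoss2017, §2 (PDF pp. 5–6)] [cite: Agarwal2000DifferenceEquations, Remark 1.8.1 (1.8.8)] -/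
theorem tilted_designValue_avg_le_cutoff {t T D : ℕ} {Bv : ℝ} {C : Finset ℕ} {w : ℕ → ℝ}
    (hdes : IsExactDesign n t T D Bv C w) {N : ℕ} (hn : (univ : Finset (Fin n)).card = 2 * N)
    (H : Finset (Fin n)) {h s₀ a₀ a₁ R : ℕ} (hh : H.card = h) (ht : t = 2 * s₀ + 1) (ha₀ : a₀ + 2 ≤ D) (ha₀T : a₀ ≤ T)
    (ha₁ : a₁ ≤ a₀ + 1) (hR : 1 ≤ R) (hR1 : R + 3 * (D + 1) + h + (T - 1) / 2 ≤ s₀)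
    (hR2 : R + 3 * (D + 1) + h + s₀ + (T - 1) / 2 + 2 ≤ N)
    (hq : ((h : ℝ) / R) ^ 2 * Real.exp (3 * h / R) ≤ 2) {θ : ℝ}
    (hθ : ((((T - 1) / 2 : ℕ)) : ℝ) * ((1 / 4 : ℝ) * ((h : ℝ) / R) ^ 2 * Real.exp (3 * h / R)) ≤ θ) (hθ1 : θ ≤ 1)
    {ρ : ℝ} (hρ0 : 0 ≤ ρ)
    (hρ : ∀ b : ℕ, b + 2 * a₁ < h → ((b : ℝ) + 1) * ((b : ℝ) + 2) ≤ ρ * (((h - b : ℕ) : ℝ) * (((n - h - b : ℕ)) : ℝ)))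
    (ψ : ℤ → ℝ) {G : ℝ} (hG0 : 0 ≤ G) (hG : ∀ x ∈ Icc (0 : ℤ) (t : ℤ), |ψ x| ≤ G)
    (hψ0 : ∀ x ∈ Icc (0 : ℤ) (t : ℤ), 0 ≤ ψ x)
    (v : PMatch n → Fin n → ℝ) (hv : ∀ M p, |v M p| ≤ 1)
    (hvA : ∀ (M : PMatch n) p p', p ∈ H → M.2.partner p ∈ H → p' ∈ H → M.2.partner p' ∈ H → v M p = v M p')
    (hvB : ∀ (M : PMatch n) p p', ((p ∈ H ∧ M.2.partner p ∉ H) ∨ (p ∉ H ∧ M.2.partner p ∈ H)) →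
      ((p' ∈ H ∧ M.2.partner p' ∉ H) ∨ (p' ∉ H ∧ M.2.partner p' ∈ H)) → v M p = v M p')
    (hvD : ∀ (M : PMatch n) p p', p ∉ H → M.2.partner p ∉ H → p' ∉ H → M.2.partner p' ∉ H → v M p = v M p') :
    ∑ M : PMatch n, ∑ U : OddSet n, levelWeight n t C w U M *
        (ψ ((U.1 ∩ H).card : ℤ) *
          (∑ p : Fin n, v M p * ((if p ∈ U.1 then (1 : ℝ) else 0) * (if M.2.partner p ∈ U.1 then (1 : ℝ) else 0))) ^ 2) ≤
      Bv * G * (5 * (t : ℝ) + 5 * T + 4) ^ 2 * ((3 : ℝ) ^ a₀ * θ ^ (D - a₀ - 1)) +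
        ((h : ℝ) + 1) * ρ ^ (a₀ + 1 - a₁) * ((n : ℝ) ^ 2 * G * Bv) := by
  classical
  have hBv : 0 ≤ Bv := le_trans (sum_nonneg fun c _ => abs_nonneg _) hdes.2.2.2.2.2.2
  have hθ0 : 0 ≤ θ := le_trans (by positivity) hθ
  set V : PMatch n → ℝ := fun M => (Fintype.card (PMatch n) : ℝ) * ∑ U : OddSet n, levelWeight n t C w U M *
    (ψ ((U.1 ∩ H).card : ℤ) *
      (∑ p : Fin n, v M p * ((if p ∈ U.1 then (1 : ℝ) else 0) * (if M.2.partner p ∈ U.1 then (1 : ℝ) else 0))) ^ 2)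
    with hVdef
  have hsumV : ∑ M : PMatch n, ∑ U : OddSet n, levelWeight n t C w U M *
      (ψ ((U.1 ∩ H).card : ℤ) *
        (∑ p : Fin n, v M p * ((if p ∈ U.1 then (1 : ℝ) else 0) * (if M.2.partner p ∈ U.1 then (1 : ℝ) else 0))) ^ 2) =
      ∑ M : PMatch n, (Fintype.card (PMatch n) : ℝ)⁻¹ * V M := by
    refine sum_congr rfl fun M _ => ?_
    have hPM : (Fintype.card (PMatch n) : ℝ) ≠ 0 := Nat.cast_ne_zero.2 (Fintype.card_pos_iff.2 ⟨M⟩).ne'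
    rw [hVdef]
    simp only []
    rw [← mul_assoc, inv_mul_cancel₀ hPM, one_mul]
  rw [hsumV]
  have hbad := card_pmatch_internal_gt_le_cutoff H (a₀ := a₀) ha₁ hρ0 (by rw [hh]; exact hρ)
  rw [hh] at hbad
  refine avg_le_of_split (fun M : PMatch n => H.card < (M.1.filter (Crosses H)).card + 2 * (a₀ + 1)) V
    (by positivity) (by positivity) (by positivity)
    (fun M hM => tilted_value_le_uniform hdes hn H hh ht ha₀ ha₀T hR hR1 hR2 hq hθ hθ1 ψ hG0 hG hψ0 M hM (v M) (hv M)
      (hvA M) (hvB M) (hvD M))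
    (fun M => tilted_value_le_trivial hdes M H ψ hG0 hG (v M) (hv M)) ?_
  have e : (univ.filter fun M : PMatch n => ¬ (H.card < (M.1.filter (Crosses H)).card + 2 * (a₀ + 1))) =
      (univ.filter fun M : PMatch n => (M.1.filter (Crosses H)).card + 2 * (a₀ + 1) ≤ H.card) :=
    filter_congr fun M _ => by omega
  rw [e, hh]
  exact hbad

/-- **HEADLINE FORM (blocks of size `≲ √n/3`, at `3^{−D/2}`).** With `a₁ = 0`, `ρ = h(h+1)/(n−2h+1) ≤ 1/9` (`9h(h+1) ≤ n−2h+1`),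
`θ ≤ 1/9`, `a₀ = ⌊D/2⌋ − 1` (`4 ≤ D`, `D/2 ≤ T+1`) and the hypotheses of `tilted_designValue_avg_le_cutoff`:
`Σ_M Σ_U W(U,M)·ψ(|U∩H|)·(Σ_p v_M(p) x_p x_{πp})² ≤ B_v·G·((5t+5T+4)² + (h+1)·n²)·(1/3)^{⌊D/2⌋−1}` for every type-constant
direction field `|v_M| ≤ 1`. [cite: Rothvoss2017, §2 (PDF pp. 5–6)] [cite: Agarwal2000DifferenceEquations, Remark 1.8.1 (1.8.8)] -/
theorem tilted_designValue_avg_le_three_pow {t T D : ℕ} {Bv : ℝ} {C : Finset ℕ} {w : ℕ → ℝ}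
    (hdes : IsExactDesign n t T D Bv C w) {N : ℕ} (hn : (univ : Finset (Fin n)).card = 2 * N)
    (H : Finset (Fin n)) {h s₀ R : ℕ} (hh : H.card = h) (h9 : 9 * (h * (h + 1)) ≤ n - 2 * h + 1) (h2h : 2 * h ≤ n)
    (ht : t = 2 * s₀ + 1) (hD4 : 4 ≤ D) (hDT : D / 2 ≤ T + 1) (hR : 1 ≤ R) (hR1 : R + 3 * (D + 1) + h + (T - 1) / 2 ≤ s₀)
    (hR2 : R + 3 * (D + 1) + h + s₀ + (T - 1) / 2 + 2 ≤ N) (hq : ((h : ℝ) / R) ^ 2 * Real.exp (3 * h / R) ≤ 2)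
    (hθ : ((((T - 1) / 2 : ℕ)) : ℝ) * ((1 / 4 : ℝ) * ((h : ℝ) / R) ^ 2 * Real.exp (3 * h / R)) ≤ 1 / 9)
    (ψ : ℤ → ℝ) {G : ℝ} (hG0 : 0 ≤ G) (hG : ∀ x ∈ Icc (0 : ℤ) (t : ℤ), |ψ x| ≤ G)
    (hψ0 : ∀ x ∈ Icc (0 : ℤ) (t : ℤ), 0 ≤ ψ x)
    (v : PMatch n → Fin n → ℝ) (hv : ∀ M p, |v M p| ≤ 1)
    (hvA : ∀ (M : PMatch n) p p', p ∈ H → M.2.partner p ∈ H → p' ∈ H → M.2.partner p' ∈ H → v M p = v M p')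
    (hvB : ∀ (M : PMatch n) p p', ((p ∈ H ∧ M.2.partner p ∉ H) ∨ (p ∉ H ∧ M.2.partner p ∈ H)) →
      ((p' ∈ H ∧ M.2.partner p' ∉ H) ∨ (p' ∉ H ∧ M.2.partner p' ∈ H)) → v M p = v M p')
    (hvD : ∀ (M : PMatch n) p p', p ∉ H → M.2.partner p ∉ H → p' ∉ H → M.2.partner p' ∉ H → v M p = v M p') :
    ∑ M : PMatch n, ∑ U : OddSet n, levelWeight n t C w U M *
        (ψ ((U.1 ∩ H).card : ℤ) *
          (∑ p : Fin n, v M p * ((if p ∈ U.1 then (1 : ℝ) else 0) * (if M.2.partner p ∈ U.1 then (1 : ℝ) else 0))) ^ 2) ≤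
      Bv * G * ((5 * (t : ℝ) + 5 * T + 4) ^ 2 + ((h : ℝ) + 1) * (n : ℝ) ^ 2) * (1 / 3 : ℝ) ^ (D / 2 - 1) := by
  have hBv : 0 ≤ Bv := le_trans (sum_nonneg fun c _ => abs_nonneg _) hdes.2.2.2.2.2.2
  have hρ9 : (h : ℝ) * ((h : ℝ) + 1) / ((n - 2 * h + 1 : ℕ) : ℝ) ≤ 1 / 9 := by
    have hden : (0 : ℝ) < ((n - 2 * h + 1 : ℕ) : ℝ) := by positivity
    rw [div_le_iff₀ hden]
    have : (9 : ℝ) * ((h : ℝ) * ((h : ℝ) + 1)) ≤ ((n - 2 * h + 1 : ℕ) : ℝ) := by exact_mod_cast h9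
    linarith
  have hρ0 : 0 ≤ (h : ℝ) * ((h : ℝ) + 1) / ((n - 2 * h + 1 : ℕ) : ℝ) := by positivity
  set a₀ := D / 2 - 1 with ha₀
  have h1 := tilted_designValue_avg_le_cutoff hdes hn H hh ht (a₀ := a₀) (a₁ := 0) (by omega) (by omega) (by omega) hR hR1
    hR2 hq hθ (by norm_num) hρ0 (fun b hb => rho_hyp_of_le h2h (by omega)) ψ hG0 hG hψ0 v hv hvA hvB hvD
  refine h1.trans ?_
  -- `3^{a₀}(1/9)^{D−a₀−1} ≤ (1/3)^{a₀}` and `ρ^{a₀+1} ≤ (1/9)^{a₀+1} ≤ (1/3)^{a₀}`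
  have hle : a₀ + 1 ≤ D - a₀ - 1 := by omega
  have e1 : (3 : ℝ) ^ a₀ * (1 / 9 : ℝ) ^ (D - a₀ - 1) ≤ (1 / 3 : ℝ) ^ a₀ := by
    calc (3 : ℝ) ^ a₀ * (1 / 9 : ℝ) ^ (D - a₀ - 1) ≤ (3 : ℝ) ^ a₀ * (1 / 9 : ℝ) ^ (a₀ + 1) :=
          mul_le_mul_of_nonneg_left (pow_le_pow_of_le_one (by norm_num) (by norm_num) hle) (by positivity)
      _ = (1 / 3 : ℝ) ^ a₀ * (1 / 9) := by
          rw [pow_succ, ← mul_assoc, ← mul_pow]; norm_num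
      _ ≤ (1 / 3 : ℝ) ^ a₀ := by
          have : (0 : ℝ) ≤ (1 / 3 : ℝ) ^ a₀ := by positivity
          linarith
  have e2 : ((h : ℝ) * ((h : ℝ) + 1) / ((n - 2 * h + 1 : ℕ) : ℝ)) ^ (a₀ + 1 - 0) ≤ (1 / 3 : ℝ) ^ a₀ := by
    rw [Nat.sub_zero]
    calc _ ≤ (1 / 9 : ℝ) ^ (a₀ + 1) := pow_le_pow_left₀ hρ0 hρ9 _
      _ = (1 / 3 : ℝ) ^ a₀ * ((1 / 3 : ℝ) ^ a₀ * (1 / 9)) := by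
          rw [pow_succ, show (1 / 9 : ℝ) = (1 / 3) * (1 / 3) by norm_num, mul_pow]; ring
      _ ≤ (1 / 3 : ℝ) ^ a₀ * 1 := by
          refine mul_le_mul_of_nonneg_left ?_ (by positivity)
          have : (1 / 3 : ℝ) ^ a₀ ≤ 1 := pow_le_one₀ (by norm_num) (by norm_num)
          nlinarith
      _ = (1 / 3 : ℝ) ^ a₀ := mul_one _
  have hθpow : (1 / 9 : ℝ) ^ (D - a₀ - 1) ≥ 0 := by positivity
  have hK1 : 0 ≤ Bv * G * (5 * (t : ℝ) + 5 * T + 4) ^ 2 := by positivity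
  have hK2 : 0 ≤ ((h : ℝ) + 1) * ((n : ℝ) ^ 2 * G * Bv) := by positivity
  calc Bv * G * (5 * (t : ℝ) + 5 * T + 4) ^ 2 * ((3 : ℝ) ^ a₀ * (1 / 9 : ℝ) ^ (D - a₀ - 1)) +
        ((h : ℝ) + 1) * ((h : ℝ) * ((h : ℝ) + 1) / ((n - 2 * h + 1 : ℕ) : ℝ)) ^ (a₀ + 1 - 0) * ((n : ℝ) ^ 2 * G * Bv)
      ≤ Bv * G * (5 * (t : ℝ) + 5 * T + 4) ^ 2 * (1 / 3 : ℝ) ^ a₀ + ((h : ℝ) + 1) * (1 / 3 : ℝ) ^ a₀ * ((n : ℝ) ^ 2 * G * Bv) :=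
        add_le_add (mul_le_mul_of_nonneg_left e1 hK1)
          (mul_le_mul_of_nonneg_right (mul_le_mul_of_nonneg_left e2 (by positivity)) (by positivity))
    _ = Bv * G * ((5 * (t : ℝ) + 5 * T + 4) ^ 2 + ((h : ℝ) + 1) * (n : ℝ) ^ 2) * (1 / 3 : ℝ) ^ (D / 2 - 1) := by
        rw [ha₀]; ring

/-- **HEADLINE WITH A CUT-OFF (blocks up to `≍ √(n·dq n)`).** With `a₀ = ⌊D/2⌋ − 1`, a cut-off `a₁ ≤ ⌊D/2⌋` such that
`9h(h+1) ≤ (2a₁+1)(n−2h+2a₁+1)` (i.e. `a₁ ≳ 5h²/n`), `θ ≤ 1/9` and the hypotheses of `tilted_designValue_avg_le_cutoff`: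
`Σ_M Σ_U W(U,M)·ψ(|U∩H|)·(Σ_p v_M(p) x_p x_{πp})² ≤ B_v·G·((5t+5T+4)²·(1/3)^{⌊D/2⌋−1} + (h+1)·n²·(1/9)^{⌊D/2⌋−a₁})`.
[cite: Rothvoss2017, §2 (PDF pp. 5–6)] [cite: Agarwal2000DifferenceEquations, Remark 1.8.1 (1.8.8)] -/
theorem tilted_designValue_avg_le_cutoff_pow {t T D : ℕ} {Bv : ℝ} {C : Finset ℕ} {w : ℕ → ℝ}
    (hdes : IsExactDesign n t T D Bv C w) {N : ℕ} (hn : (univ : Finset (Fin n)).card = 2 * N)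
    (H : Finset (Fin n)) {h s₀ a₁ R : ℕ} (hh : H.card = h)
    (h9 : 9 * (h * (h + 1)) ≤ (2 * a₁ + 1) * (n - 2 * h + 2 * a₁ + 1)) (h2h : 2 * h ≤ n)
    (ht : t = 2 * s₀ + 1) (hD4 : 4 ≤ D) (hDT : D / 2 ≤ T + 1) (ha₁ : a₁ ≤ D / 2) (hR : 1 ≤ R)
    (hR1 : R + 3 * (D + 1) + h + (T - 1) / 2 ≤ s₀)
    (hR2 : R + 3 * (D + 1) + h + s₀ + (T - 1) / 2 + 2 ≤ N) (hq : ((h : ℝ) / R) ^ 2 * Real.exp (3 * h / R) ≤ 2)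
    (hθ : ((((T - 1) / 2 : ℕ)) : ℝ) * ((1 / 4 : ℝ) * ((h : ℝ) / R) ^ 2 * Real.exp (3 * h / R)) ≤ 1 / 9)
    (ψ : ℤ → ℝ) {G : ℝ} (hG0 : 0 ≤ G) (hG : ∀ x ∈ Icc (0 : ℤ) (t : ℤ), |ψ x| ≤ G)
    (hψ0 : ∀ x ∈ Icc (0 : ℤ) (t : ℤ), 0 ≤ ψ x)
    (v : PMatch n → Fin n → ℝ) (hv : ∀ M p, |v M p| ≤ 1)
    (hvA : ∀ (M : PMatch n) p p', p ∈ H → M.2.partner p ∈ H → p' ∈ H → M.2.partner p' ∈ H → v M p = v M p')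
    (hvB : ∀ (M : PMatch n) p p', ((p ∈ H ∧ M.2.partner p ∉ H) ∨ (p ∉ H ∧ M.2.partner p ∈ H)) →
      ((p' ∈ H ∧ M.2.partner p' ∉ H) ∨ (p' ∉ H ∧ M.2.partner p' ∈ H)) → v M p = v M p')
    (hvD : ∀ (M : PMatch n) p p', p ∉ H → M.2.partner p ∉ H → p' ∉ H → M.2.partner p' ∉ H → v M p = v M p') :
    ∑ M : PMatch n, ∑ U : OddSet n, levelWeight n t C w U M *
        (ψ ((U.1 ∩ H).card : ℤ) *
          (∑ p : Fin n, v M p * ((if p ∈ U.1 then (1 : ℝ) else 0) * (if M.2.partner p ∈ U.1 then (1 : ℝ) else 0))) ^ 2) ≤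
      Bv * G * ((5 * (t : ℝ) + 5 * T + 4) ^ 2 * (1 / 3 : ℝ) ^ (D / 2 - 1) +
        ((h : ℝ) + 1) * (n : ℝ) ^ 2 * (1 / 9 : ℝ) ^ (D / 2 - a₁)) := by
  have hBv : 0 ≤ Bv := le_trans (sum_nonneg fun c _ => abs_nonneg _) hdes.2.2.2.2.2.2
  set ρ : ℝ := (h : ℝ) * ((h : ℝ) + 1) / (((2 * a₁ + 1 : ℕ) : ℝ) * ((n - 2 * h + 2 * a₁ + 1 : ℕ) : ℝ)) with hρdef
  have hρ0 : 0 ≤ ρ := by rw [hρdef]; positivity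
  have hρ9 : ρ ≤ 1 / 9 := by
    have hden : (0 : ℝ) < ((2 * a₁ + 1 : ℕ) : ℝ) * ((n - 2 * h + 2 * a₁ + 1 : ℕ) : ℝ) := by positivity
    rw [hρdef, div_le_iff₀ hden]
    have : (9 : ℝ) * ((h : ℝ) * ((h : ℝ) + 1)) ≤ ((2 * a₁ + 1 : ℕ) : ℝ) * ((n - 2 * h + 2 * a₁ + 1 : ℕ) : ℝ) := by
      exact_mod_cast h9
    linarith
  set a₀ := D / 2 - 1 with ha₀
  have h1 := tilted_designValue_avg_le_cutoff hdes hn H hh ht (a₀ := a₀) (a₁ := a₁) (by omega) (by omega) (by omega) hR hR1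
    hR2 hq hθ (by norm_num) hρ0 (fun b hb => by rw [hρdef]; exact rho_hyp_cutoff h2h hb) ψ hG0 hG hψ0 v hv hvA hvB hvD
  refine h1.trans ?_
  have hle : a₀ + 1 ≤ D - a₀ - 1 := by omega
  have e1 : (3 : ℝ) ^ a₀ * (1 / 9 : ℝ) ^ (D - a₀ - 1) ≤ (1 / 3 : ℝ) ^ a₀ := by
    calc (3 : ℝ) ^ a₀ * (1 / 9 : ℝ) ^ (D - a₀ - 1) ≤ (3 : ℝ) ^ a₀ * (1 / 9 : ℝ) ^ (a₀ + 1) :=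
          mul_le_mul_of_nonneg_left (pow_le_pow_of_le_one (by norm_num) (by norm_num) hle) (by positivity)
      _ = (1 / 3 : ℝ) ^ a₀ * (1 / 9) := by
          rw [pow_succ, ← mul_assoc, ← mul_pow]; norm_num
      _ ≤ (1 / 3 : ℝ) ^ a₀ := by
          have : (0 : ℝ) ≤ (1 / 3 : ℝ) ^ a₀ := by positivity
          linarith
  have e2 : ρ ^ (a₀ + 1 - a₁) ≤ (1 / 9 : ℝ) ^ (D / 2 - a₁) := by
    rw [show a₀ + 1 - a₁ = D / 2 - a₁ by omega]
    exact pow_le_pow_left₀ hρ0 hρ9 _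
  have hK1 : 0 ≤ Bv * G * (5 * (t : ℝ) + 5 * T + 4) ^ 2 := by positivity
  calc Bv * G * (5 * (t : ℝ) + 5 * T + 4) ^ 2 * ((3 : ℝ) ^ a₀ * (1 / 9 : ℝ) ^ (D - a₀ - 1)) +
        ((h : ℝ) + 1) * ρ ^ (a₀ + 1 - a₁) * ((n : ℝ) ^ 2 * G * Bv)
      ≤ Bv * G * (5 * (t : ℝ) + 5 * T + 4) ^ 2 * (1 / 3 : ℝ) ^ a₀ +
          ((h : ℝ) + 1) * (1 / 9 : ℝ) ^ (D / 2 - a₁) * ((n : ℝ) ^ 2 * G * Bv) :=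
        add_le_add (mul_le_mul_of_nonneg_left e1 hK1)
          (mul_le_mul_of_nonneg_right (mul_le_mul_of_nonneg_left e2 (by positivity)) (by positivity))
    _ = Bv * G * ((5 * (t : ℝ) + 5 * T + 4) ^ 2 * (1 / 3 : ℝ) ^ (D / 2 - 1) +
        ((h : ℝ) + 1) * (n : ℝ) ^ 2 * (1 / 9 : ℝ) ^ (D / 2 - a₁)) := by rw [ha₀]; ring

end Summit.PneNP.PneNP.Theorems.ChebyshevTracialDesignTiltedSmallBlockAverage

end
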